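import Literature.NumberTheory.GaloisRepresentations.LocalDualityTwoZero
import Literature.NumberTheory.GaloisRepresentations.LocalDualityTwoZeroInputs
import Literature.NumberTheory.GaloisRepresentations.CyclicIndexEulerChar
import HarnessLib

/-!
# Route `ByReductionTypeAtTwo`, item `OrdKatoHalfAtTwo` (stmt-BirchSwinnertonDyer-19271), TOWER road, the
# GOOD-ORDINARY local tower kernels at `v ∣ 2` at FULL `2`-power depth: BRICK D — `#H²` of a finite module over an open
# subgroup is bounded by the number of equivariant homomorphisms into `μ` (Shapiro + local duality `(2,0)`)

HONEST FRAMING (cell `bsd-2adic`, run/shared/lean/pub/bsd-2adic/, seat `bsd-2adic-tower-1` GEN 20, HUMAN RULINGS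
D-0036 / D-0054 / D-0074): TOOL theorems only (no definition, no named fact, no `sorry`); closes nothing by itself;
nothing booked; BSD is not proved by any of this. Brick D of the programme «UNIFORM layer bound
`∃ C, ∀ n, #𝒦_{v,n}[2^∞] ≤ C` at a good ordinary `2` over `ℚ`» ⇒ `WeierstrassCurve.Greenberg1999_kerG_bounded` at `p = 2`
⇒ Mazur's control theorem `WeierstrassCurve.selmer_control` over `ℚ` at `p = 2` (Greenberg, LNM 1716, Thm. 1.2). In the
Euler–Poincaré count of BRICK C the term `#H²(H_n, Ê[2^k])` must be bounded uniformly in `k` and `n`; by Tate local duality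
it is `#Hom_{H_n}(Ê[2^k], μ_{2^k})`, which the assembly bounds by the Frobenius-fixed part of `Ẽ(𝔽₂)`. This file proves the
general inequality behind it:

* `finite_and_natCard_two_restrict_le` — for a non-archimedean local field `F` of characteristic `0`, an OPEN subgroup
  `H ≤ Γ_F`, and a finite discrete `Γ_F`-module `M` killed by `p^k`: `H²(H, M)` is finite and
  `#H²(H, M) ≤ #{f : M →+ μ_{p^k} | f is H-equivariant}`. Proof: Shapiro `H²(H, M) ≅ H²(Γ_F, M_Γ^H(M))`
  (`shapiroEquiv`), local duality `(2,0)` for the finite module `M_Γ^H(M)` (`natCard_two_eq_natCard_invariants_homRep`: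
  `#H²(Γ_F, X) = #Hom_Γ(X, μ)`), and the injection `Hom_Γ(M_Γ^H(M), μ) ↪ Hom_H(M, μ)`, `Φ ↦ Φ ∘ j`, where `j(m)` is the
  function supported on `H`, `x ↦ x m` (every `a* ∈ M_Γ^H(M)` is the finite sum over the cosets `c` of `H` of the
  translates `c.out · j(a*(c.out⁻¹))`, so `Φ` is determined by `Φ ∘ j` — Frobenius reciprocity, the half we need).

References: J.-P. Serre, *Galois Cohomology* (1997), I §2.5 (Shapiro), II §5.2; J. Milne, *Arithmetic Duality Theorems*
(2006), I Cor. 2.3 (local duality), I §0 (`M^D = Hom(M, μ)`).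
-/

set_option autoImplicit false
-- the Theorems namespace of this sub repeats the summit name by design (D-0017 nested layout: Summit.<S>.<Sub>)
set_option linter.dupNamespace false

noncomputable section

open scoped Classical

universe u

namespace Summit.BirchSwinnertonDyer.BirchSwinnertonDyer.Theorems.GoodOrdTower

open CategoryTheory Field Literature.NumberTheory.GaloisRepresentations _root_.TopRep _root_.ContRepresentation
  _root_.ContinuousCohomology Literature.NumberTheory.GaloisRepresentations.DiscreteGaloisModule

set_option maxHeartbeats 1600000 in
/-- **`#H²(H, M) ≤ #Hom_H(M, μ_{p^k})` for an open subgroup `H ≤ Γ_F` and a finite `p^k`-torsion discrete `Γ_F`-module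
`M`** (`F` a non-archimedean local field of characteristic `0`), with finiteness of `H²(H, M)`: Shapiro's isomorphism
`H²(H, M) ≅ H²(Γ_F, M_Γ^H(M))`, Tate local duality `#H²(Γ_F, X) = #Hom_Γ(X, μ_{p^k})` for the finite induced module
`X = M_Γ^H(M)`, and the injection `Hom_Γ(M_Γ^H(M), μ) ↪ Hom_H(M, μ)`, `Φ ↦ Φ ∘ j` with `j(m) = (x ↦ x m on H, 0 off H)`.
[cite: SerreGaloisCohomology1997, I §2.5 Prop. 10 and II §5.2] [cite: MilneADT2006, I Cor. 2.3] -/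
theorem finite_and_natCard_two_restrict_le (F : Type u) [Field F] [ValuativeRel F] [TopologicalSpace F]
    [IsNonarchimedeanLocalField F] [CharZero F]
    (H : Subgroup (absoluteGaloisGroup F)) [H.Normal] (hHo : IsOpen (H : Set (absoluteGaloisGroup F)))
    {M : Type u} [AddCommGroup M] [TopologicalSpace M] [DiscreteTopology M] [Finite M]
    (ρ : ContinuousRep (absoluteGaloisGroup F) ℤ M) {p k : ℕ} [Fact p.Prime] (hM : ∀ m : M, p ^ k • m = 0) :
    Finite (continuousCohomology 2 (ρ.restrict (subgroupIncl H)).toTopRep) ∧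
      Nat.card (continuousCohomology 2 (ρ.restrict (subgroupIncl H)).toTopRep) ≤
        Nat.card {f : M →+ MuCarrier F (p ^ k) // ∀ (h : H) (m : M),
          f (ρ (h : absoluteGaloisGroup F) m) = mu F (p ^ k) (h : absoluteGaloisGroup F) (f m)} := by
  -- notation and instances
  let Γ := absoluteGaloisGroup F
  haveI : CompactSpace Γ := absoluteGaloisGroup_compactSpace F
  haveI hHc : IsClosed (H : Set Γ) := Subgroup.isClosed_of_isOpen _ hHo
  haveI : DiscreteTopology (Γ ⧸ H) := QuotientGroup.discreteTopology hHo
  haveI : Finite (Γ ⧸ H) := finite_of_compact_of_discrete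
  letI : Fintype (Γ ⧸ H) := Fintype.ofFinite _
  haveI : CompactSpace H := compactSpace_of_isClosed_subgroup (S := H)
  let σ : ContinuousRep H ℤ M := ρ.restrict (subgroupIncl H)
  haveI : DiscreteTopology (coindModule σ) := discreteTopology_coind σ
  haveI : Finite (coindModule σ) := finite_coindModule F H ρ
  have hσ : ∀ (h : H) (m : M), σ h m = ρ (h : Γ) m := fun _ _ ↦ rfl
  -- Shapiro in degree `2`
  have eSh := shapiroEquiv H ρ 1
  -- local duality `(2,0)` for the finite induced module
  have hM' : ∀ f : coindModule σ, p ^ k • f = 0 := fun f ↦ Subtype.ext (by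
    ext x
    rw [Submodule.coe_smul_of_tower, ContinuousMap.coe_smul, Pi.smul_apply, hM, Submodule.coe_zero,
      ContinuousMap.zero_apply])
  obtain ⟨hfin2, hcard2⟩ := natCard_two_eq_natCard_invariants_homRep F (coindRep σ) hM'
  haveI := hfin2
  haveI hfinH : Finite (continuousCohomology 2 (ρ.restrict (subgroupIncl H)).toTopRep) := Finite.of_equiv _ eSh
  refine ⟨hfinH, ?_⟩
  rw [← Nat.card_congr eSh, hcard2]
  -- the embedding `j : M → M_Γ^H(M)`, `j(m)(x) = x m` on `H`, `0` off `H`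
  have hfront : ∀ m : M, ∀ a ∈ frontier {x : Γ | x ∈ H}, (fun x : Γ ↦ ρ x m) a = (fun _ : Γ ↦ (0 : M)) a := by
    intro m a ha
    have hcl : IsClopen {x : Γ | x ∈ H} := ⟨hHc, hHo⟩
    rw [hcl.frontier_eq] at ha
    exact absurd ha (Set.notMem_empty a)
  have hjcont : ∀ m : M, Continuous fun x : Γ ↦ if x ∈ H then ρ x m else 0 := fun m ↦
    continuous_if (hfront m) (ρ.continuous_apply_left m).continuousOn continuous_const.continuousOn
  have hjmem : ∀ m : M, (⟨fun x : Γ ↦ if x ∈ H then ρ x m else 0, hjcont m⟩ : C(Γ, M)) ∈ coindModule σ := by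
    intro m
    rw [mem_coind_iff]
    intro s x
    change (if (s : Γ) * x ∈ H then ρ ((s : Γ) * x) m else 0) = σ s (if x ∈ H then ρ x m else 0)
    by_cases hx : x ∈ H
    · rw [if_pos hx, if_pos (H.mul_mem s.2 hx), hσ, map_mul, Module.End.mul_apply]
    · have hsx : (s : Γ) * x ∉ H := fun h ↦ hx (by simpa using H.mul_mem (H.inv_mem s.2) h)
      rw [if_neg hx, if_neg hsx, map_zero]
  let j : M →+ coindModule σ :=
    { toFun := fun m ↦ ⟨_, hjmem m⟩
      map_zero' := Subtype.ext (ContinuousMap.ext fun x ↦ by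
        change (if x ∈ H then ρ x (0 : M) else 0) = 0
        rw [map_zero, ite_self])
      map_add' := fun m m' ↦ Subtype.ext (ContinuousMap.ext fun x ↦ by
        change (if x ∈ H then ρ x (m + m') else 0) =
          (if x ∈ H then ρ x m else 0) + (if x ∈ H then ρ x m' else 0)
        by_cases hx : x ∈ H
        · rw [if_pos hx, if_pos hx, if_pos hx, map_add]
        · rw [if_neg hx, if_neg hx, if_neg hx, add_zero]) }
  have hj : ∀ (m : M) (x : Γ), ((j m : coindModule σ) : C(Γ, M)) x = if x ∈ H then ρ x m else 0 := fun _ _ ↦ rfl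
  -- `j` is `H`-equivariant: `j(h m) = h · j(m)`
  have hjeq : ∀ (h : H) (m : M), j (ρ (h : Γ) m) = coindRep σ (h : Γ) (j m) := by
    intro h m
    refine Subtype.ext (ContinuousMap.ext fun x ↦ ?_)
    rw [hj, coindRep_apply_apply, hj]
    by_cases hx : x ∈ H
    · rw [if_pos hx, if_pos (H.mul_mem hx h.2), map_mul, Module.End.mul_apply]
    · have hxh : x * (h : Γ) ∉ H := fun h' ↦ hx (by simpa using H.mul_mem h' (H.inv_mem h.2))
      rw [if_neg hx, if_neg hxh]
  -- every `a* ∈ M_Γ^H(M)` is the sum over the cosets `c` of `c.out · j(a*(c.out⁻¹))`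
  have hdec : ∀ f : coindModule σ,
      f = ∑ c : Γ ⧸ H, coindRep σ c.out (j (((f : coindModule σ) : C(Γ, M)) c.out⁻¹)) := by
    intro f
    refine Subtype.ext (ContinuousMap.ext fun x ↦ ?_)
    rw [Submodule.coe_sum, ContinuousMap.coe_sum, Finset.sum_apply]
    -- only the coset `c₀ = x⁻¹ H` contributes
    have hx0 : x * (QuotientGroup.mk x⁻¹ : Γ ⧸ H).out ∈ H := by
      have h := QuotientGroup.out_eq' (QuotientGroup.mk x⁻¹ : Γ ⧸ H)
      rw [QuotientGroup.eq] at h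
      simpa using H.inv_mem h
    rw [Finset.sum_eq_single (QuotientGroup.mk x⁻¹ : Γ ⧸ H)]
    · rw [coindRep_apply_apply, hj, if_pos hx0]
      have h := (mem_coind_iff σ (f : C(Γ, M))).1 f.2 ⟨_, hx0⟩ ((QuotientGroup.mk x⁻¹ : Γ ⧸ H).out)⁻¹
      rw [hσ] at h
      change (f : C(Γ, M)) (x * _ * _) = _ at h
      rw [mul_inv_cancel_right] at h
      exact h
    · intro c _ hc
      rw [coindRep_apply_apply, hj, if_neg]
      intro hxc
      apply hc
      rw [← QuotientGroup.out_eq' c, eq_comm, QuotientGroup.eq, inv_inv]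
      exact hxc
    · intro h; exact absurd (Finset.mem_univ _) h
  -- invariants of `Hom(M_Γ^H(M), μ)` = `Γ`-equivariant maps; `Φ ↦ Φ ∘ j` is injective
  let Ψ : ((coindRep σ).homRep (mu F (p ^ k))).toTopRep.ρ.invariants →
      {f : M →+ MuCarrier F (p ^ k) // ∀ (h : H) (m : M), f (ρ (h : Γ) m) = mu F (p ^ k) (h : Γ) (f m)} :=
    fun Φ ↦ ⟨((Φ : HomCarrier (coindModule σ) (MuCarrier F (p ^ k))) : coindModule σ →+ MuCarrier F (p ^ k)).comp j,
      fun h m ↦ by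
        have hinv := (ContinuousRep.homRep_apply_eq_self_iff (coindRep σ) (mu F (p ^ k)) (h : Γ)
          (Φ : HomCarrier (coindModule σ) (MuCarrier F (p ^ k)))).mp (Φ.2 (h : Γ))
        rw [AddMonoidHom.comp_apply, AddMonoidHom.comp_apply, hjeq]
        exact (hinv (j m)).symm⟩
  have hΨ : Function.Injective Ψ := by
    intro Φ Φ' hΦ
    have hcomp : ∀ m : M, (Φ : HomCarrier (coindModule σ) (MuCarrier F (p ^ k))) (j m) =
        (Φ' : HomCarrier (coindModule σ) (MuCarrier F (p ^ k))) (j m) := fun m ↦ by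
      have h := congrArg (fun f : {f : M →+ MuCarrier F (p ^ k) // ∀ (h : H) (m : M),
          f (ρ (h : Γ) m) = mu F (p ^ k) (h : Γ) (f m)} ↦ (f.1 m)) hΦ
      exact h
    have hinv : ∀ (Θ : ((coindRep σ).homRep (mu F (p ^ k))).toTopRep.ρ.invariants) (g : Γ) (f : coindModule σ),
        (Θ : HomCarrier (coindModule σ) (MuCarrier F (p ^ k))) (coindRep σ g f) =
          mu F (p ^ k) g ((Θ : HomCarrier (coindModule σ) (MuCarrier F (p ^ k))) f) := fun Θ g f ↦
      ((ContinuousRep.homRep_apply_eq_self_iff (coindRep σ) (mu F (p ^ k)) g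
        (Θ : HomCarrier (coindModule σ) (MuCarrier F (p ^ k)))).mp (Θ.2 g) f).symm
    refine Subtype.ext (HomCarrier.ext fun f ↦ ?_)
    rw [hdec f, map_sum, map_sum]
    refine Finset.sum_congr rfl fun c _ ↦ ?_
    rw [hinv Φ, hinv Φ', hcomp]
  haveI : Finite {f : M →+ MuCarrier F (p ^ k) // ∀ (h : H) (m : M),
      f (ρ (h : Γ) m) = mu F (p ^ k) (h : Γ) (f m)} := by
    haveI : Finite (MuCarrier F (p ^ k)) := by
      haveI : NeZero (p ^ k) := ⟨pow_ne_zero k (Fact.out : p.Prime).ne_zero⟩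
      exact Finite.of_equiv _ (muEquivZMod F (p ^ k)).toEquiv.symm
    haveI : Finite (M →+ MuCarrier F (p ^ k)) := Finite.of_injective (fun f : M →+ MuCarrier F (p ^ k) ↦ (f : M → _))
      (fun f g h ↦ AddMonoidHom.ext fun m ↦ congrFun h m)
    exact Finite.of_injective _ Subtype.val_injective
  exact Nat.card_le_card_of_injective Ψ hΨ

end Summit.BirchSwinnertonDyer.BirchSwinnertonDyer.Theorems.GoodOrdTower

end
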